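import Summits.AtomisticToContinuum.FouriersLaw.Theorems.PhononMeanFreePathCoherentDephasingStrictAbsorptionPrep
import Summits.AtomisticToContinuum.FouriersLaw.Theorems.PhononMeanFreePathCoherentDephasingStrictAbsorptionClassBounds

/-!
# Strict absorption — `N`-uniform sizes of the curvature witness and of the third generator power
# (line `Sketch`, crux `PhononMeanFreePath.CoherentDephasing`, stmt-AtomisticToContinuum-11810, lead c2)

Two `N`-UNIFORM bounds for the assembly of the strict-absorption theorem, both from the `N`-uniform even Gibbs
moments (`prep_uniform_even_moments`):

* `uniform_curvature_sq` / `sa_uniformCurvature` (registered) — `∫ Φ² dμ_N ≤ C_V` and hence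
  `Var_{μ_N}(Φ) ≤ C_V` for all `N ≥ 2`, `Φ = ω₂ + 3 lam q₀² + 1 + 3β(q₁-q₀)²` the local curvature at the kicked site;
* `uniform_localPoly_sq` — for ANY continuous `G` on the `(N+1)`-site phase space with the local bound
  `|G| ≤ C₃ (1 + Σ_{i ≤ 2} (q_i⁶ + p_i⁶))`: `∫ G² dμ_N ≤ 2 C₃² (1 + 36 C₆)` with `C₆` the uniform twelfth-moment bound
  (the local sum is supported on at most three sites: Cauchy–Schwarz with the factor `3`, not `N+1`).

No definition, no `sorry`, standard axioms.
-/

noncomputable section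

open MeasureTheory ProbabilityTheory Filter Topology Set
open scoped NNReal ENNReal

namespace Summit.AtomisticToContinuum.FouriersLaw.Theorems.CoherentDephasing.StrictAbsorption

open Literature.MathematicalPhysics.KineticTheory.HeatConduction
open Literature.MathematicalPhysics.KineticTheory Literature.Probability.Process OscillatorChain

section Uniform

variable {ω₂ lam β γ : ℝ} (hω : 0 < ω₂) (hl : 0 ≤ lam) (hβ : 0 < β) {T : ℝ} (hT : 0 < T)
include hω hl hβ hT

/-- **`N`-uniform second moment of the local curvature**: there is `C_V > 0` with `Φ, Φ² ∈ L¹(μ_N)`,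
`∫ Φ² dμ_N ≤ C_V` and `∫ (Φ - ∫Φ)² dμ_N ≤ C_V` for every `N ≥ 2` (`Φ² ≤ 3(ω₂+1)² + 27 lam² q₀⁴ + 27β²(q₁-q₀)⁴`,
`(q₁-q₀)⁴ ≤ 8(q₀⁴+q₁⁴)`, uniform fourth moments). [folklore] -/
theorem uniform_curvature_sq :
    ∃ CV : ℝ, 0 < CV ∧ ∀ (N : ℕ) (hN : 2 ≤ N),
      Integrable (fun z : PhaseSpace (N + 1) => (ω₂ + 3 * lam * z.1 0 ^ 2 + 1 + 3 * β * (z.1 ⟨1, by omega⟩ - z.1 0) ^ 2)) ((pinnedChain ω₂ lam β γ).gibbsMeasure (N + 1) T) ∧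
      Integrable (fun z : PhaseSpace (N + 1) => (ω₂ + 3 * lam * z.1 0 ^ 2 + 1 + 3 * β * (z.1 ⟨1, by omega⟩ - z.1 0) ^ 2) ^ 2) ((pinnedChain ω₂ lam β γ).gibbsMeasure (N + 1) T) ∧
      ∫ z, (ω₂ + 3 * lam * z.1 0 ^ 2 + 1 + 3 * β * (z.1 ⟨1, by omega⟩ - z.1 0) ^ 2) ^ 2 ∂((pinnedChain ω₂ lam β γ).gibbsMeasure (N + 1) T) ≤ CV ∧
      ∫ z, ((ω₂ + 3 * lam * z.1 0 ^ 2 + 1 + 3 * β * (z.1 ⟨1, by omega⟩ - z.1 0) ^ 2) - ∫ x, (ω₂ + 3 * lam * x.1 0 ^ 2 + 1 + 3 * β * (x.1 ⟨1, by omega⟩ - x.1 0) ^ 2) ∂((pinnedChain ω₂ lam β γ).gibbsMeasure (N + 1) T)) ^ 2 ∂((pinnedChain ω₂ lam β γ).gibbsMeasure (N + 1) T) ≤ CV := by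
  obtain ⟨C4, hC4⟩ := prep_uniform_even_moments hω hl hβ hT 2
  set CV : ℝ := 3 * (ω₂ + 1) ^ 2 + 27 * lam ^ 2 * |C4| + 27 * β ^ 2 * (16 * |C4|) + 1 with hCV
  refine ⟨CV, by positivity, fun N hN => ?_⟩
  set P := pinnedChain ω₂ lam β γ with hP
  set μ := P.gibbsMeasure (N + 1) T with hμ
  haveI : IsProbabilityMeasure μ := pinnedChain_isProbabilityMeasure_gibbsMeasure hω hl hβ.le γ (N + 1) hT
  set Φf : PhaseSpace (N + 1) → ℝ := fun z => (ω₂ + 3 * lam * z.1 0 ^ 2 + 1 + 3 * β * (z.1 ⟨1, by omega⟩ - z.1 0) ^ 2) with hΦf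
  have hΦc : Continuous Φf := by rw [hΦf]; fun_prop
  -- size `|Φ| ≤ CΦ (1+H)`
  have hΦb : ∀ y, |Φf y| ≤ (ω₂ + 1 + 6 * lam / ω₂ + 6 * β) * (1 + P.hamiltonian (N + 1) y) ^ 1 := fun y => by
    obtain ⟨h0, h1⟩ := classBd_phi_bounds hω hl hβ.le γ hN y
    rw [hΦf]; dsimp only; rw [abs_of_nonneg h0, pow_one]; exact h1
  have hΦi : Integrable Φf μ := statics_integrable_of_le_pow hω hl hβ.le γ (N + 1) hT 1 hΦc hΦb
  have hΦ2i : Integrable (fun z => Φf z ^ 2) μ := by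
    refine statics_integrable_of_le_pow hω hl hβ.le γ (N + 1) hT 2 (hΦc.pow 2)
      (C := (ω₂ + 1 + 6 * lam / ω₂ + 6 * β) ^ 2) fun y => ?_
    have h := hΦb y
    rw [pow_one] at h
    rw [abs_of_nonneg (sq_nonneg _), ← sq_abs, ← mul_pow]
    exact pow_le_pow_left₀ (abs_nonneg _) h 2
  -- the fourth moments at sites 0 and 1
  have h1lt : 1 < N + 1 := by omega
  obtain ⟨hq0i, -, hq0, -⟩ := hC4 (N + 1) 0
  obtain ⟨hq1i, -, hq1, -⟩ := hC4 (N + 1) ⟨1, h1lt⟩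
  have hq0' : ∫ z, z.1 0 ^ 4 ∂μ ≤ |C4| := (by simpa using hq0 : ∫ z, z.1 0 ^ 4 ∂μ ≤ C4).trans (le_abs_self _)
  have hq1' : ∫ z, z.1 ⟨1, h1lt⟩ ^ 4 ∂μ ≤ |C4| :=
    (by simpa using hq1 : ∫ z, z.1 ⟨1, h1lt⟩ ^ 4 ∂μ ≤ C4).trans (le_abs_self _)
  have hq0i' : Integrable (fun z : PhaseSpace (N + 1) => z.1 0 ^ 4) μ := by simpa using hq0i
  have hq1i' : Integrable (fun z : PhaseSpace (N + 1) => z.1 ⟨1, h1lt⟩ ^ 4) μ := by simpa using hq1i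
  -- pointwise `Φ² ≤ 3(ω₂+1)² + 27 lam² q₀⁴ + 27 β² · 8 (q₀⁴ + q₁⁴)`
  have hpt : ∀ z : PhaseSpace (N + 1), Φf z ^ 2 ≤
      3 * (ω₂ + 1) ^ 2 + 27 * lam ^ 2 * z.1 0 ^ 4 + 27 * β ^ 2 * (8 * (z.1 0 ^ 4 + z.1 ⟨1, by omega⟩ ^ 4)) := by
    intro z
    rw [hΦf]; dsimp only
    set q := z.1 0
    set q' := z.1 ⟨1, by omega⟩
    have h4 : (q' - q) ^ 4 ≤ 8 * (q ^ 4 + q' ^ 4) := by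
      nlinarith [sq_nonneg (q + q'), sq_nonneg (q - q'), sq_nonneg (q ^ 2 - q' ^ 2), sq_nonneg (q * q'),
        sq_nonneg ((q' - q) ^ 2), sq_nonneg (q ^ 2 + q' ^ 2)]
    have e : ω₂ + 3 * lam * q ^ 2 + 1 + 3 * β * (q' - q) ^ 2 = (ω₂ + 1) + 3 * lam * q ^ 2 + 3 * β * (q' - q) ^ 2 := by ring
    rw [e]
    have h3 : ((ω₂ + 1) + 3 * lam * q ^ 2 + 3 * β * (q' - q) ^ 2) ^ 2 ≤
        3 * ((ω₂ + 1) ^ 2 + (3 * lam * q ^ 2) ^ 2 + (3 * β * (q' - q) ^ 2) ^ 2) := by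
      nlinarith [sq_nonneg ((ω₂ + 1) - 3 * lam * q ^ 2), sq_nonneg ((ω₂ + 1) - 3 * β * (q' - q) ^ 2),
        sq_nonneg (3 * lam * q ^ 2 - 3 * β * (q' - q) ^ 2)]
    have h5 : (3 * β * (q' - q) ^ 2) ^ 2 = 9 * β ^ 2 * (q' - q) ^ 4 := by ring
    have h6 : (3 * lam * q ^ 2) ^ 2 = 9 * lam ^ 2 * q ^ 4 := by ring
    rw [h5, h6] at h3
    nlinarith [mul_le_mul_of_nonneg_left h4 (by positivity : (0:ℝ) ≤ 9 * β ^ 2)]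
  have i1 : Integrable (fun z : PhaseSpace (N + 1) => 3 * (ω₂ + 1) ^ 2 + 27 * lam ^ 2 * z.1 0 ^ 4) μ :=
    (integrable_const _).add (hq0i'.const_mul _)
  have i2 : Integrable (fun z : PhaseSpace (N + 1) => 27 * β ^ 2 * (8 * (z.1 0 ^ 4 + z.1 ⟨1, by omega⟩ ^ 4))) μ :=
    ((hq0i'.add hq1i').const_mul _).const_mul _
  have hdomI : Integrable (fun z : PhaseSpace (N + 1) =>
      3 * (ω₂ + 1) ^ 2 + 27 * lam ^ 2 * z.1 0 ^ 4 + 27 * β ^ 2 * (8 * (z.1 0 ^ 4 + z.1 ⟨1, by omega⟩ ^ 4))) μ :=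
    i1.add i2
  have hint : ∫ z, Φf z ^ 2 ∂μ ≤ CV := by
    have e1 : ∫ z, (3 * (ω₂ + 1) ^ 2 + 27 * lam ^ 2 * z.1 0 ^ 4 +
        27 * β ^ 2 * (8 * (z.1 0 ^ 4 + z.1 ⟨1, by omega⟩ ^ 4))) ∂μ =
        3 * (ω₂ + 1) ^ 2 + 27 * lam ^ 2 * ∫ z, z.1 0 ^ 4 ∂μ +
          27 * β ^ 2 * (8 * ((∫ z, z.1 0 ^ 4 ∂μ) + ∫ z, z.1 ⟨1, by omega⟩ ^ 4 ∂μ)) := by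
      rw [integral_add i1 i2, integral_add (integrable_const _) (hq0i'.const_mul _), integral_const, probReal_univ,
        one_smul, integral_const_mul, integral_const_mul, integral_const_mul, integral_add hq0i' hq1i']
    calc ∫ z, Φf z ^ 2 ∂μ ≤ ∫ z, (3 * (ω₂ + 1) ^ 2 + 27 * lam ^ 2 * z.1 0 ^ 4 +
          27 * β ^ 2 * (8 * (z.1 0 ^ 4 + z.1 ⟨1, by omega⟩ ^ 4))) ∂μ := integral_mono hΦ2i hdomI hpt
      _ ≤ CV := by
          rw [e1, hCV]
          have : 0 ≤ |C4| := abs_nonneg _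
          nlinarith [mul_nonneg (sq_nonneg lam) this, mul_nonneg (sq_nonneg β) this,
            mul_le_mul_of_nonneg_left hq0' (by positivity : (0:ℝ) ≤ 27 * lam ^ 2),
            mul_le_mul_of_nonneg_left (add_le_add hq0' hq1') (by positivity : (0:ℝ) ≤ 27 * β ^ 2 * 8)]
  -- the variance is at most the second moment
  have hvar : ∫ z, (Φf z - ∫ x, Φf x ∂μ) ^ 2 ∂μ ≤ ∫ z, Φf z ^ 2 ∂μ := by
    set m := ∫ x, Φf x ∂μ
    have e : (fun z => (Φf z - m) ^ 2) = fun z => (Φf z ^ 2 - 2 * m * Φf z) + m ^ 2 := by funext z; ring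
    have j1 : Integrable (fun z => Φf z ^ 2 - 2 * m * Φf z) μ := hΦ2i.sub (hΦi.const_mul _)
    have h1 : ∫ z, (Φf z ^ 2 - 2 * m * Φf z) + m ^ 2 ∂μ = (∫ z, Φf z ^ 2 - 2 * m * Φf z ∂μ) + ∫ _z, m ^ 2 ∂μ :=
      integral_add j1 (integrable_const _)
    have h2 : ∫ z, Φf z ^ 2 - 2 * m * Φf z ∂μ = (∫ z, Φf z ^ 2 ∂μ) - ∫ z, 2 * m * Φf z ∂μ :=
      integral_sub hΦ2i (hΦi.const_mul _)
    rw [e, h1, h2, integral_const_mul, integral_const, probReal_univ, one_smul]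
    nlinarith [sq_nonneg m]
  exact ⟨hΦi, hΦ2i, hint, hvar.trans hint⟩

/-- **`N`-uniform `L²` size of a locally bounded observable**: with `C₆` the uniform bound on the twelfth moments,
if `G` is continuous and `|G| ≤ C₃ (1 + Σ_{i≤2}(q_i⁶ + p_i⁶))` on the `(N+1)`-site phase space (`N ≥ 2`), then
`G² ∈ L¹(μ_N)` and `∫ G² dμ_N ≤ 2 C₃² (1 + 36 C₆)`. [folklore] -/
theorem uniform_localPoly_sq :
    ∃ C₆ : ℝ, 0 ≤ C₆ ∧ ∀ (N : ℕ) (_ : 2 ≤ N) (G : PhaseSpace (N + 1) → ℝ) (C₃ : ℝ), Continuous G →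
      (∀ z, |G z| ≤ C₃ * (1 + ∑ i : Fin (N + 1), if (i : ℕ) ≤ 2 then z.1 i ^ 6 + z.2 i ^ 6 else 0)) →
      Integrable (fun z => G z ^ 2) ((pinnedChain ω₂ lam β γ).gibbsMeasure (N + 1) T) ∧
      ∫ z, G z ^ 2 ∂((pinnedChain ω₂ lam β γ).gibbsMeasure (N + 1) T) ≤ 2 * C₃ ^ 2 * (1 + 36 * C₆) := by
  obtain ⟨C, hC⟩ := prep_uniform_even_moments hω hl hβ hT 6
  refine ⟨|C|, abs_nonneg _, fun N hN G C₃ hGc hGb => ?_⟩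
  set P := pinnedChain ω₂ lam β γ with hP
  set μ := P.gibbsMeasure (N + 1) T with hμ
  haveI : IsProbabilityMeasure μ := pinnedChain_isProbabilityMeasure_gibbsMeasure hω hl hβ.le γ (N + 1) hT
  set s : Finset (Fin (N + 1)) := Finset.univ.filter fun i => (i : ℕ) ≤ 2 with hs
  set S : PhaseSpace (N + 1) → ℝ := fun z => ∑ i ∈ s, (z.1 i ^ 6 + z.2 i ^ 6) with hS
  have hSeq : ∀ z : PhaseSpace (N + 1),
      (∑ i : Fin (N + 1), if (i : ℕ) ≤ 2 then z.1 i ^ 6 + z.2 i ^ 6 else 0) = S z := fun z => by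
    rw [hS]; dsimp only; rw [hs, Finset.sum_filter]
  have hcard : s.card ≤ 3 := by
    have h := Finset.card_le_card_of_injOn (s := s) (t := Finset.range 3) (fun i : Fin (N + 1) => (i : ℕ))
      (fun i hi => by
        rw [hs, Finset.coe_filter] at hi
        simp only [Finset.coe_range, Set.mem_Iio]
        exact Nat.lt_succ_of_le hi.2)
      (fun i _ j _ hij => Fin.ext hij)
    simpa using h
  have hc3 : (s.card : ℝ) ≤ 3 := by exact_mod_cast hcard
  -- `S² ≤ 3 Σ_{i∈s} (q_i⁶+p_i⁶)² ≤ 6 Σ_{i∈s} (q_i¹² + p_i¹²)`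
  have hS2 : ∀ z, S z ^ 2 ≤ 6 * ∑ i ∈ s, (z.1 i ^ 12 + z.2 i ^ 12) := by
    intro z
    have h1 : (∑ i ∈ s, (z.1 i ^ 6 + z.2 i ^ 6)) ^ 2 ≤ s.card * ∑ i ∈ s, (z.1 i ^ 6 + z.2 i ^ 6) ^ 2 :=
      sq_sum_le_card_mul_sum_sq
    have h2 : ∑ i ∈ s, (z.1 i ^ 6 + z.2 i ^ 6) ^ 2 ≤ ∑ i ∈ s, 2 * (z.1 i ^ 12 + z.2 i ^ 12) :=
      Finset.sum_le_sum fun i _ => by nlinarith [sq_nonneg (z.1 i ^ 6 - z.2 i ^ 6)]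
    have h3 : 0 ≤ ∑ i ∈ s, (z.1 i ^ 6 + z.2 i ^ 6) ^ 2 := Finset.sum_nonneg fun i _ => sq_nonneg _
    have h4 : ∑ i ∈ s, 2 * (z.1 i ^ 12 + z.2 i ^ 12) = 2 * ∑ i ∈ s, (z.1 i ^ 12 + z.2 i ^ 12) := by
      rw [Finset.mul_sum]
    calc S z ^ 2 = (∑ i ∈ s, (z.1 i ^ 6 + z.2 i ^ 6)) ^ 2 := by rw [hS]
      _ ≤ s.card * ∑ i ∈ s, (z.1 i ^ 6 + z.2 i ^ 6) ^ 2 := h1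
      _ ≤ 3 * ∑ i ∈ s, (z.1 i ^ 6 + z.2 i ^ 6) ^ 2 := mul_le_mul_of_nonneg_right hc3 h3
      _ ≤ 3 * (2 * ∑ i ∈ s, (z.1 i ^ 12 + z.2 i ^ 12)) := by rw [← h4]; linarith
      _ = 6 * ∑ i ∈ s, (z.1 i ^ 12 + z.2 i ^ 12) := by ring
  -- integrability and integrals of the twelfth moments over `s`
  have h12i : ∀ i : Fin (N + 1), Integrable (fun z : PhaseSpace (N + 1) => z.1 i ^ 12 + z.2 i ^ 12) μ := fun i => by
    obtain ⟨hq, hp, -, -⟩ := hC (N + 1) i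
    exact (by simpa using hq : Integrable (fun z : PhaseSpace (N + 1) => z.1 i ^ 12) μ).add
      (by simpa using hp : Integrable (fun z : PhaseSpace (N + 1) => z.2 i ^ 12) μ)
  have h12b : ∀ i : Fin (N + 1), ∫ z, z.1 i ^ 12 + z.2 i ^ 12 ∂μ ≤ 2 * |C| := fun i => by
    obtain ⟨hq, hp, hqb, hpb⟩ := hC (N + 1) i
    have hqi : Integrable (fun z : PhaseSpace (N + 1) => z.1 i ^ 12) μ := by simpa using hq
    have hpi : Integrable (fun z : PhaseSpace (N + 1) => z.2 i ^ 12) μ := by simpa using hp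
    have hqb' : ∫ z, z.1 i ^ 12 ∂μ ≤ C := by simpa using hqb
    have hpb' : ∫ z, z.2 i ^ 12 ∂μ ≤ C := by simpa using hpb
    rw [integral_add hqi hpi]
    linarith [le_abs_self C]
  have hsumI : Integrable (fun z => ∑ i ∈ s, (z.1 i ^ 12 + z.2 i ^ 12)) μ :=
    integrable_finsetSum _ fun i _ => h12i i
  have hsumB : ∫ z, ∑ i ∈ s, (z.1 i ^ 12 + z.2 i ^ 12) ∂μ ≤ 6 * |C| := by
    rw [integral_finsetSum _ fun i _ => h12i i]
    calc ∑ i ∈ s, ∫ z, (z.1 i ^ 12 + z.2 i ^ 12) ∂μ ≤ ∑ _i ∈ s, 2 * |C| := Finset.sum_le_sum fun i _ => h12b i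
      _ = s.card * (2 * |C|) := by rw [Finset.sum_const, nsmul_eq_mul]
      _ ≤ 3 * (2 * |C|) := mul_le_mul_of_nonneg_right hc3 (by positivity)
      _ = 6 * |C| := by ring
  -- `G² ≤ 2 C₃² (1 + 6 Σ …)`
  have hGb' : ∀ z, G z ^ 2 ≤ 2 * C₃ ^ 2 * (1 + 6 * ∑ i ∈ s, (z.1 i ^ 12 + z.2 i ^ 12)) := by
    intro z
    have h := hGb z
    rw [hSeq z] at h
    have hS0 : 0 ≤ S z := by rw [hS]; exact Finset.sum_nonneg fun i _ => by positivity
    have h1 : G z ^ 2 ≤ (C₃ * (1 + S z)) ^ 2 := by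
      rw [← sq_abs (G z)]; exact pow_le_pow_left₀ (abs_nonneg _) h 2
    have h2 : (1 + S z) ^ 2 ≤ 2 * (1 + S z ^ 2) := by nlinarith [sq_nonneg (1 - S z)]
    have h3 : 1 + S z ^ 2 ≤ 1 + 6 * ∑ i ∈ s, (z.1 i ^ 12 + z.2 i ^ 12) := by linarith [hS2 z]
    calc G z ^ 2 ≤ (C₃ * (1 + S z)) ^ 2 := h1
      _ = C₃ ^ 2 * (1 + S z) ^ 2 := by ring
      _ ≤ C₃ ^ 2 * (2 * (1 + S z ^ 2)) := mul_le_mul_of_nonneg_left h2 (sq_nonneg _)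
      _ ≤ C₃ ^ 2 * (2 * (1 + 6 * ∑ i ∈ s, (z.1 i ^ 12 + z.2 i ^ 12))) :=
          mul_le_mul_of_nonneg_left (mul_le_mul_of_nonneg_left h3 (by norm_num)) (sq_nonneg _)
      _ = 2 * C₃ ^ 2 * (1 + 6 * ∑ i ∈ s, (z.1 i ^ 12 + z.2 i ^ 12)) := by ring
  have hdom0 : Integrable (fun z => 1 + 6 * ∑ i ∈ s, (z.1 i ^ 12 + z.2 i ^ 12)) μ :=
    (integrable_const _).add (hsumI.const_mul 6)
  have hdom : Integrable (fun z => 2 * C₃ ^ 2 * (1 + 6 * ∑ i ∈ s, (z.1 i ^ 12 + z.2 i ^ 12))) μ :=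
    hdom0.const_mul _
  have hG2i : Integrable (fun z => G z ^ 2) μ :=
    hdom.mono' (hGc.pow 2).aestronglyMeasurable (ae_of_all _ fun z => by
      rw [Real.norm_eq_abs, abs_of_nonneg (sq_nonneg _)]; exact hGb' z)
  refine ⟨hG2i, ?_⟩
  have e1 : ∫ z, 2 * C₃ ^ 2 * (1 + 6 * ∑ i ∈ s, (z.1 i ^ 12 + z.2 i ^ 12)) ∂μ =
      2 * C₃ ^ 2 * (1 + 6 * ∫ z, ∑ i ∈ s, (z.1 i ^ 12 + z.2 i ^ 12) ∂μ) := by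
    rw [integral_const_mul, integral_add (integrable_const _) (hsumI.const_mul 6), integral_const, probReal_univ,
      one_smul, integral_const_mul]
  calc ∫ z, G z ^ 2 ∂μ ≤ ∫ z, 2 * C₃ ^ 2 * (1 + 6 * ∑ i ∈ s, (z.1 i ^ 12 + z.2 i ^ 12)) ∂μ := integral_mono hG2i hdom hGb'
    _ = 2 * C₃ ^ 2 * (1 + 6 * ∫ z, ∑ i ∈ s, (z.1 i ^ 12 + z.2 i ^ 12) ∂μ) := e1
    _ ≤ 2 * C₃ ^ 2 * (1 + 36 * |C|) :=
        mul_le_mul_of_nonneg_left (by linarith [hsumB]) (by positivity)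

end Uniform

/-- **Registered form of the `N`-uniform curvature moments** (stub `sa_uniformCurvature`): `∫ Φ² dμ_N ≤ C_V` and
`Var_{μ_N}(Φ) ≤ C_V` for all `N ≥ 2`. [folklore] -/
theorem sa_uniformCurvature :
    ∀ ω₂ lam β γ : ℝ, 0 < ω₂ → 0 < lam → 0 < β → 0 < γ → ∀ T : ℝ, 0 < T → ∃ CV : ℝ, 0 < CV ∧ ∀ (N : ℕ) (hN : 2 ≤ N), ∫ z, (ω₂ + 3 * lam * z.1 0 ^ 2 + 1 + 3 * β * (z.1 ⟨1, by omega⟩ - z.1 0) ^ 2) ^ 2 ∂((pinnedChain ω₂ lam β γ).gibbsMeasure (N + 1) T) ≤ CV ∧ ∫ z, ((ω₂ + 3 * lam * z.1 0 ^ 2 + 1 + 3 * β * (z.1 ⟨1, by omega⟩ - z.1 0) ^ 2) - ∫ x, (ω₂ + 3 * lam * x.1 0 ^ 2 + 1 + 3 * β * (x.1 ⟨1, by omega⟩ - x.1 0) ^ 2) ∂((pinnedChain ω₂ lam β γ).gibbsMeasure (N + 1) T)) ^ 2 ∂((pinnedChain ω₂ lam β γ).gibbsMeasure (N + 1) T)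 ≤ CV := by
  intro ω₂ lam β γ hω hl hβ _ T hT
  obtain ⟨CV, hCV, h⟩ := uniform_curvature_sq hω hl.le hβ hT
  exact ⟨CV, hCV, fun N hN => ⟨(h N hN).2.2.1, (h N hN).2.2.2⟩⟩

end Summit.AtomisticToContinuum.FouriersLaw.Theorems.CoherentDephasing.StrictAbsorption

end
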